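import Literature.NumberTheory.EllipticCurves.Rank1Residual.Typed.Basic
import Literature.NumberTheory.EllipticCurves.Wuthrich2014.ShaBoundProofs
import Literature.NumberTheory.EllipticCurves.AnalyticRankOrderProofs
import HarnessLib

/-!
# The PUBLISHED half at construction-shaped pairs of analytic rank `0`: Wuthrich's upper bound `ord_p #Ш ≤ ord_p #Ш_an`

HONEST FRAMING (cell `b2b-bsdres`): construction-shaped classes are TYPED, not attempted; this file
only records, kernel-checked, which HALF of the missing output (`Rank1Residual/Typed/Basic.lean`) is
already a published theorem, so that the per-class `MissingInputAt` can be stated as exactly the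
other half. Theorems only (no definition, no named fact).

For an elliptic curve `E/ℚ` with `L(E,1) ≠ 0` and an odd prime `p` at which `E` does NOT have
additive reduction and `ρ̄_{E,p}` is reducible or surjective, Wuthrich, Doc. Math. 19 (2014),
Prop. 21 (p. 400) — tree fact `Wuthrich2014.sha_dvd_analyticSha`, consequences in
`Wuthrich2014/ShaBoundProofs.lean` (prover x1b of the cell) — gives `ord_p #Ш(E/ℚ) ≤ ord_p #Ш(E/ℚ)_an`,
i.e. the "Euler-system half" `MissingUpperBoundAt W p`. This applies to the rank-`0` parts of the
construction classes X2 (multiplicative Eisenstein `p`: reducible, not additive), X7 and X8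
(supersingular `p`, good: when `ρ̄_{E,p}` is surjective) and to X6; it does NOT apply to X3/X4
(additive `p`) — exactly Wuthrich's excluded constant `C` ("only divisible by 2, primes of additive
reduction or primes for which the representation is neither surjective nor contained in a Borel").
So at those pairs the missing input is the LOWER bound `ord_p #Ш_an ≤ ord_p #Ш` alone (the
Eisenstein-congruence / main-conjecture direction).

References: Wuthrich 2014 Prop. 21 [Wuthrich2014]; Miller 2011 §1 [Miller2011LMS]; GZK = bsd.S17
[Darmon2004].
-/

noncomputable section

open scoped Classical

open WeierstrassCurve Literature.NumberTheory.EllipticCurves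
  Literature.NumberTheory.EllipticCurves.Rank1Residual
  Literature.NumberTheory.EllipticCurves.Wuthrich2014

namespace Literature.NumberTheory.EllipticCurves.Rank1Residual.Typed

variable (W : WeierstrassCurve ℚ) [W.IsElliptic] [W.IsGloballyMinimal] (p : ℕ) [Fact p.Prime]

/-- **The upper-bound half is in print at odd non-additive `p` with Borel-or-surjective image, in
analytic rank `0`** (Wuthrich 2014 Prop. 21, via `padicValNat_shaOrder_le_of_sha_dvd` and
`shaAn_eq_of_L_one_div_eq` of `Wuthrich2014/ShaBoundProofs`): `MissingUpperBoundAt W p`, granted the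
named facts `hW` (Prop. 21), `hGZK` (bsd.S17) and `hmod` (modularity, for `r_an = 0 ⇒ L(E,1) ≠ 0`).
[cite: Wuthrich2014, Prop. 21 (p. 400)] [cite: Miller2011LMS, §1] -/
theorem missingUpperBoundAt_of_wuthrich (hW : sha_dvd_analyticSha)
    (hGZK : rank_eq_analyticRank_of_analyticRank_le_one) (hmod : hasEntireLFunction_rat)
    (hp : p ≠ 2) (hr : W.analyticRank = 0)
    (hadd : ¬ ((W.baseChange ℚ_[p]).minimal ℤ_[p]).HasAdditiveReduction ℤ_[p])
    (himg : ¬ W.HasIrreducibleModPGaloisRep p ∨ W.HasSurjectiveModNGaloisRep p) :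
    MissingUpperBoundAt W p := by
  have hL : W.entireLFunction 1 ≠ 0 := (W.analyticRank_eq_zero_iff_holds (hmod W)).1 hr
  obtain ⟨hrank, hfin⟩ := hGZK W (by omega)
  have hmw0 : W.mordellWeilRank = 0 := by omega
  haveI hE : Finite W.toAffine.Point := W.finite_point_of_rank_zero hmw0
  obtain ⟨q, hq, -, hle⟩ := padicValNat_shaOrder_le_of_sha_dvd hW W p hp hL hE hfin hadd himg
  obtain ⟨-, -, -, hshaAn⟩ := shaAn_eq_of_L_one_div_eq hGZK W hL hq
  exact ⟨_, hshaAn, hle⟩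

/-- At such pairs the missing input is the LOWER bound alone: Wuthrich's upper bound plus a
(missing) `MissingLowerBoundAt W p` give the full missing output, hence `BSD(E,p)`.
[cite: Wuthrich2014, Prop. 21 (p. 400)] [cite: Miller2011LMS, §1 and Def. 1.1] -/
theorem bsdp_of_missingLowerBoundAt_of_wuthrich (hW : sha_dvd_analyticSha)
    (hGZK : rank_eq_analyticRank_of_analyticRank_le_one) (hmod : hasEntireLFunction_rat)
    (hp : p ≠ 2) (hr : W.analyticRank = 0)
    (hadd : ¬ ((W.baseChange ℚ_[p]).minimal ℤ_[p]).HasAdditiveReduction ℤ_[p])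
    (himg : ¬ W.HasIrreducibleModPGaloisRep p ∨ W.HasSurjectiveModNGaloisRep p)
    (hlow : MissingLowerBoundAt W p) : BSDp W p :=
  bsdp_of_missingPPartAt W p hGZK (by omega)
    (missingPPartAt_of_lower_of_upper W p hlow
      (missingUpperBoundAt_of_wuthrich W p hW hGZK hmod hp hr hadd himg))

end Literature.NumberTheory.EllipticCurves.Rank1Residual.Typed
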